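import Mathlib.Analysis.Convex.Function
import Summits.HubbardSuperconductivity.HubbardSuperconductivity.Theorems.ThermalWedgeTwSeededEnsembleEquivalenceRSourcedPressureBasics

/-!
# Crux `TwSeededEnsembleEquivalenceR` (stmt-HubbardSuperconductivity-15581), line `cold-floor-collapse`
# (slug `Sketch`, skeleton v6/v7) — FINITE-VOLUME (engine-facing) form of DEEP-SCONC

Support file (`--supports stmt-HubbardSuperconductivity-15581`; sorry-free; no definition).

The regulated physics stub DEEP-UNIQ′ (`stub_sourcedColdUniqDeep`) follows from DEEP-SCONC — strict concavity of
`s ↦ q(μ,√s)` on the regulated range `[e^{−a/(2U)}, (13g+1)²]` for every pointwise thermodynamic limit `q` of the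
sourced torus pressure at the cold slice (`usc_stub_sourcedColdUniqDeep_of_deepStrictConcavity`,
…RDeepUniqOfStrictConcavity). STRICT concavity does not pass to pointwise limits; what does is a concavity MODULUS.
A convergent expansion two source-derivatives deep delivers exactly that in finite volume: `∂²_s p̃_L ≤ −m < 0` on the
regulated range, uniformly in large `L` (at `U = 0`: `−(2/L²)Σ_k 16φ_k⁴ (tanh x − x sech² x)/E_k³`, `x = βE_k/2`, bounded
away from `0` on compacts off the zone diagonal measure-zero set). This file proves, kernel-checked:

* `dsc_deepStrictConcavity_of_finiteVolumeModulus` — **DEEP-SCONC-FV ⟹ DEEP-SCONC**: if for every interior `μ` there is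
  `m > 0` such that for all regulated `s₁ ≠ s₂` and `t ∈ (0,1)`, eventually in `L`,
  `t·p̃_L(μ,√s₁) + (1−t)·p̃_L(μ,√s₂) + m·t(1−t)(s₁−s₂)² ≤ p̃_L(μ,√(t s₁ + (1−t) s₂))` (strong concavity in `s` of the
  finite-volume sourced pressure on the regulated range, `L`-uniform modulus), then every pointwise limit `q` has
  `StrictConcaveOn ℝ [e^{−a/(2U)}, (13g+1)²] (s ↦ q μ √s)` — the hypothesis of the DEEP-UNIQ′ normal form, verbatim.
  [folklore: limits preserve non-strict inequalities; the modulus supplies strictness]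
-/

set_option linter.dupNamespace false

namespace Summit.HubbardSuperconductivity.HubbardSuperconductivity.Theorems

open Matrix Set Literature.MathematicalPhysics.QuantumLattice
open Summit.HubbardSuperconductivity.HubbardSuperconductivity.Theorems.TwSeededEnsembleEquivalenceR.ColdFloorLine
open scoped ComplexOrder

noncomputable section

/-- Affine combinations of limits inherit eventual inequalities: if `uₙ → A`, `vₙ → B`, `wₙ → C` (`ε`–`N` form),
`0 ≤ t ≤ 1`, and `t uₙ + (1−t) vₙ + D ≤ wₙ` eventually, then `t A + (1−t) B + D ≤ C`. [folklore] -/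
theorem dsc_affine_le_of_limits {u v w : ℕ → ℝ} {A B C D t : ℝ} (ht0 : 0 ≤ t) (ht1 : t ≤ 1)
    (hu : ∀ κ : ℝ, 0 < κ → ∃ N : ℕ, ∀ n, N ≤ n → |u n - A| ≤ κ)
    (hv : ∀ κ : ℝ, 0 < κ → ∃ N : ℕ, ∀ n, N ≤ n → |v n - B| ≤ κ)
    (hw : ∀ κ : ℝ, 0 < κ → ∃ N : ℕ, ∀ n, N ≤ n → |w n - C| ≤ κ)
    (huvw : ∃ N₀ : ℕ, ∀ n, N₀ ≤ n → t * u n + (1 - t) * v n + D ≤ w n) :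
    t * A + (1 - t) * B + D ≤ C := by
  apply le_of_forall_pos_lt_add
  intro ε hε
  obtain ⟨N₁, hN₁⟩ := hu (ε / 4) (by positivity)
  obtain ⟨N₂, hN₂⟩ := hv (ε / 4) (by positivity)
  obtain ⟨N₃, hN₃⟩ := hw (ε / 4) (by positivity)
  obtain ⟨N₀, hN₀⟩ := huvw
  set n := max N₀ (max N₁ (max N₂ N₃)) with hn
  have h0 := hN₀ n (le_max_left _ _)
  have h1 := hN₁ n ((le_max_left _ _).trans (le_max_right _ _))
  have h2 := hN₂ n (((le_max_left _ _).trans (le_max_right _ _)).trans (le_max_right _ _))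
  have h3 := hN₃ n (((le_max_right _ _).trans (le_max_right _ _)).trans (le_max_right _ _))
  rw [abs_le] at h1 h2 h3
  have ht1' : 0 ≤ 1 - t := by linarith
  have e1 : t * (u n - A) ≥ -(t * (ε / 4)) := by nlinarith [h1.1]
  have e2 : (1 - t) * (v n - B) ≥ -((1 - t) * (ε / 4)) := by nlinarith [h2.1]
  nlinarith [h3.2, e1, e2]

/-- **DEEP-SCONC-FV ⟹ DEEP-SCONC (finite-volume strong `s`-concavity with an `L`-uniform modulus on the regulated
range gives strict `s`-concavity of every pointwise limit).** The conclusion is VERBATIM the hypothesis of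
`usc_stub_sourcedColdUniqDeep_of_deepStrictConcavity` (…RDeepUniqOfStrictConcavity), so DEEP-SCONC-FV ⟹ DEEP-UNIQ′
(`stub_sourcedColdUniqDeep` of skeleton v6) by composing the two. [folklore composition] -/
theorem dsc_deepStrictConcavity_of_finiteVolumeModulus :
    (∀ (μ₁ μ₂ : ℝ), -4 < μ₁ → μ₁ < μ₂ → μ₂ < 0 → ∃ a₁ : ℝ, 0 < a₁ ∧ ∀ a ∈ Set.Ioc (0 : ℝ) a₁,
      ∃ K' U₀ : ℝ, 0 < K' ∧ 0 < U₀ ∧ ∀ U ∈ Set.Ioc (0 : ℝ) U₀, ∀ g ∈ Set.Icc (K' * U) (1 / 10),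
        ∀ μ ∈ Set.Ioo μ₁ μ₂, ∃ m : ℝ, 0 < m ∧ ∀ s₁ s₂ t : ℝ,
          Real.exp (-(a / (2 * U))) ≤ s₁ → s₁ ≤ (13 * g + 1) ^ 2 →
          Real.exp (-(a / (2 * U))) ≤ s₂ → s₂ ≤ (13 * g + 1) ^ 2 → s₁ ≠ s₂ → 0 < t → t < 1 →
            ∃ L₀ : ℕ, ∀ (L : ℕ) [NeZero L], L₀ ≤ L →
              t * (Real.log (Matrix.partitionFn (Real.exp (a / U)) (dWaveSourceTorus L U μ (Real.sqrt s₁))).re /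
                  (Real.exp (a / U) * (L : ℝ) ^ 2)) +
                (1 - t) * (Real.log (Matrix.partitionFn (Real.exp (a / U))
                  (dWaveSourceTorus L U μ (Real.sqrt s₂))).re / (Real.exp (a / U) * (L : ℝ) ^ 2)) +
                m * t * (1 - t) * (s₁ - s₂) ^ 2 ≤
              Real.log (Matrix.partitionFn (Real.exp (a / U))
                  (dWaveSourceTorus L U μ (Real.sqrt (t * s₁ + (1 - t) * s₂)))).re /
                (Real.exp (a / U) * (L : ℝ) ^ 2)) →
    ∀ (μ₁ μ₂ : ℝ), -4 < μ₁ → μ₁ < μ₂ → μ₂ < 0 → ∃ a₁ : ℝ, 0 < a₁ ∧ ∀ a ∈ Set.Ioc (0 : ℝ) a₁,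
      ∃ K' U₀ : ℝ, 0 < K' ∧ 0 < U₀ ∧ ∀ U ∈ Set.Ioc (0 : ℝ) U₀, ∀ g ∈ Set.Icc (K' * U) (1 / 10),
        ∀ q : ℝ → ℝ → ℝ,
          (∀ μ ∈ Set.Icc μ₁ μ₂, ∀ h ∈ Set.Icc (-(13 * g + 1)) (13 * g + 1), ∀ κ : ℝ, 0 < κ →
            ∃ L₀ : ℕ, ∀ (L : ℕ) [NeZero L], L₀ ≤ L →
              |Real.log (Matrix.partitionFn (Real.exp (a / U)) (dWaveSourceTorus L U μ h)).re /
                  (Real.exp (a / U) * (L : ℝ) ^ 2) - q μ h| ≤ κ) →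
          ∀ μ ∈ Set.Ioo μ₁ μ₂,
            StrictConcaveOn ℝ (Set.Icc (Real.exp (-(a / (2 * U)))) ((13 * g + 1) ^ 2))
              (fun s : ℝ => q μ (Real.sqrt s)) := by
  intro hF μ₁ μ₂ h4 h12 h0
  obtain ⟨a₁, ha₁, hA⟩ := hF μ₁ μ₂ h4 h12 h0
  refine ⟨a₁, ha₁, fun a ha => ?_⟩
  obtain ⟨K', U₀, hK', hU₀, hB⟩ := hA a ha
  refine ⟨K', U₀, hK', hU₀, fun U hU g hg q hq μ hμ => ?_⟩
  obtain ⟨m, hm, hmod⟩ := hB U hU g hg μ hμ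
  set R : ℝ := 13 * g + 1 with hR_def
  have hg0 : 0 < g := lt_of_lt_of_le (mul_pos hK' hU.1) hg.1
  have hR : 0 < R := by rw [hR_def]; positivity
  set β : ℝ := Real.exp (a / U) with hβ_def
  have hμ' : μ ∈ Set.Icc μ₁ μ₂ := ⟨hμ.1.le, hμ.2.le⟩
  -- the square root of a point of `[e^{−a/(2U)}, R²]` is an admissible source
  have hsqrt_mem : ∀ s ∈ Set.Icc (Real.exp (-(a / (2 * U)))) (R ^ 2), Real.sqrt s ∈ Set.Icc (-R) R := by
    intro s hs
    refine ⟨by linarith [Real.sqrt_nonneg s], ?_⟩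
    rw [← Real.sqrt_sq hR.le]
    exact Real.sqrt_le_sqrt hs.2
  -- sequence form (side `n + 1`) of the limit at `μ`, sources `√s`
  have hseq : ∀ s ∈ Set.Icc (Real.exp (-(a / (2 * U)))) (R ^ 2), ∀ κ : ℝ, 0 < κ → ∃ N : ℕ, ∀ n, N ≤ n →
      |Real.log (partitionFn β (dWaveSourceTorus (n + 1) U μ (Real.sqrt s))).re / (β * ((n + 1 : ℕ) : ℝ) ^ 2) -
          q μ (Real.sqrt s)| ≤ κ := by
    intro s hs κ hκ
    obtain ⟨L₁, hL₁⟩ := hq μ hμ' (Real.sqrt s) (hsqrt_mem s hs) κ hκ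
    exact ⟨L₁, fun n hn => hL₁ (n + 1) (by omega)⟩
  refine ⟨convex_Icc _ _, ?_⟩
  intro s₁ hs₁ s₂ hs₂ hne t t' ht ht' htt'
  have ht1 : t < 1 := by linarith
  have ht'eq : t' = 1 - t := by linarith
  subst ht'eq
  -- the combination point lies in the regulated range
  have hc_mem : t * s₁ + (1 - t) * s₂ ∈ Set.Icc (Real.exp (-(a / (2 * U)))) (R ^ 2) := by
    constructor
    · nlinarith [hs₁.1, hs₂.1]
    · nlinarith [hs₁.2, hs₂.2]
  obtain ⟨L₀, hL₀⟩ := hmod s₁ s₂ t hs₁.1 hs₁.2 hs₂.1 hs₂.2 hne ht ht1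
  have hlim := dsc_affine_le_of_limits (D := m * t * (1 - t) * (s₁ - s₂) ^ 2) ht.le ht1.le
    (hseq s₁ hs₁) (hseq s₂ hs₂) (hseq _ hc_mem) ⟨L₀, fun n hn => ?_⟩
  · have hpos : 0 < m * t * (1 - t) * (s₁ - s₂) ^ 2 := by
      have hne' : s₁ - s₂ ≠ 0 := sub_ne_zero.mpr hne
      have : 0 < (s₁ - s₂) ^ 2 := by positivity
      have h1t : 0 < 1 - t := by linarith
      positivity
    simp only [smul_eq_mul]
    linarith
  · have := hL₀ (n + 1) (by omega)
    simpa [mul_assoc] using this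

end

end Summit.HubbardSuperconductivity.HubbardSuperconductivity.Theorems
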